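import Literature.Analysis.FunctionSpaces.TorusInverseLaplacianCalculus
import Literature.Analysis.FunctionSpaces.TorusFourierConvolution
import Literature.Analysis.FunctionSpaces.TorusApproximateIdentity
import Literature.Analysis.FunctionSpaces.TorusMollifier
import HarnessLib

/-!
# Weakly harmonic integrable functions on the flat torus are a.e. constant

Analysis/FunctionSpaces support file (theorem-only). The uniqueness half of the very weak
Poisson problem on `T^d` (Robinson–Rodrigo–Sadowski 2016, Thm. 2.6 / Lemma 5.1: the pressure is
determined up to an additive constant; Grafakos 2014, Prop. 3.2.4): if `f ∈ L¹(T^d)` satisfies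
`∫ f Δθ = 0` for all smooth `θ` — or merely for the countable family of reflected translates
`θ(z) = k_n(x − z)` of the standard mollifiers `k_n = Torus.kernel (1/(n+4))`, `x` ranging over a
dense set — then `f` is a.e. equal to its mean
(`Torus.ae_eq_const_of_forall_integral_mul_laplacian_kernel_eq_zero`,
`Torus.ae_eq_const_of_forall_integral_mul_laplacian_eq_zero`).

Proof: the mollifications `f ⋆ k_n` are smooth with `Δ(f ⋆ k_n)(x) = ∫ f(y) Δ[k_n(x − ·)](y) dy`
(`Torus.laplacian_convolution`, `Torus.laplacian_comp_sub_left`), which vanishes on the dense set,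
hence everywhere; a smooth function with vanishing Laplacian is constant
(`Torus.IsSmooth.eq_integral_of_laplacian_eq_zero`, from `𝓕(Δw)(k) = -4π²|k|²ŵ(k)`,
`Torus.mFourierCoeff_laplacian_complex`, and uniqueness of Fourier coefficients of continuous
functions, `Torus.eq_of_forall_mFourierCoeff_eq`), so `f ⋆ k_n ≡ ∫ f`; and `f ⋆ k_n → f` in `L¹`
(`Torus.tendsto_eLpNorm_convolution_sub_self_of_eventually`). The countable-family form is what a
parameter-dependent (a.e. in time) application needs.

## Mathlib search

Mathlib (this pin): `Continuous.ext_on`, `MeasureTheory.integral_convolution`, `eLpNorm_eq_zero_iff`;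
no Weyl lemma on the torus. Tree: everything on the torus side (`TorusConvolution`,
`TorusApproximateIdentity`, `TorusFourierConvolution`, `TorusInverseLaplacianCalculus`).

## References

* J. C. Robinson, J. L. Rodrigo, W. Sadowski, *The Three-Dimensional Navier–Stokes Equations*
  (CUP 2016), Thm. 2.6 and Lemma 5.1. [RobinsonRodrigoSadowskiCUP2016]
* L. Grafakos, *Classical Fourier Analysis*, 3rd ed. (2014), Prop. 3.2.4, Prop. 3.1.2 (10). [Grafakos2014]
-/

noncomputable section

open MeasureTheory Set Filter Topology Function UnitAddTorus Metric
open scoped ENNReal NNReal Convolution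

namespace Literature.Analysis.FunctionSpaces.Torus

variable {d : Type*} [Fintype d]

/-! ## Smooth functions with vanishing Laplacian are constant -/

/-- **A smooth function on `T^d` with `Δg ≡ 0` is constant**, equal to its mean: the Fourier
coefficients of `Δg` are `-4π²|k|² ĝ(k)` (`Torus.mFourierCoeff_laplacian_complex`), so `ĝ(k) = 0`
for `k ≠ 0`, and continuous functions are determined by their coefficients
(`Torus.eq_of_forall_mFourierCoeff_eq`). [cite: Grafakos2014, Prop. 3.1.2 (10) and Prop. 3.2.4] -/
theorem IsSmooth.eq_integral_of_laplacian_eq_zero {g : UnitAddTorus d → ℝ} (hg : IsSmooth g)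
    (h0 : ∀ x, Torus.laplacian g x = 0) (x : UnitAddTorus d) : g x = ∫ y, g y := by
  classical
  set w : UnitAddTorus d → ℂ := Complex.ofRealCLM ∘ g with hw
  have hws : IsSmooth w := hg.comp_clm Complex.ofRealCLM
  have hwc : Continuous w := hws.continuous
  have hLw : Torus.laplacian w = fun _ => 0 := by
    funext y
    rw [hw, laplacian_clm_comp_apply hg Complex.ofRealCLM y, h0 y, map_zero]
  have hcoef : ∀ k : d → ℤ, k ≠ 0 → mFourierCoeff w k = 0 := by
    intro k hk
    have h1 := mFourierCoeff_laplacian_complex hws k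
    rw [hLw] at h1
    have h2 : mFourierCoeff (fun _ : UnitAddTorus d => (0 : ℂ)) k = 0 := by
      have := mFourierCoeff_const_real (d := d) 0 k
      simpa using this
    rw [h2] at h1
    have hne : (-(4 * Real.pi ^ 2 * freqNormSq k : ℝ) : ℂ) ≠ 0 := by
      have hpos : 0 < 4 * Real.pi ^ 2 * freqNormSq k := by
        have := one_le_freqNormSq_of_ne_zero hk
        positivity
      exact neg_ne_zero.2 (Complex.ofReal_ne_zero.2 hpos.ne')
    exact (mul_eq_zero.1 h1.symm).resolve_left hne
  -- compare with the constant function `∫ g`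
  have hmean : mFourierCoeff w 0 = ((∫ y, g y : ℝ) : ℂ) := by
    rw [mFourierCoeff_eq_integral_conj_mul]
    simp only [mFourier_zero, ContinuousMap.one_apply, map_one, one_mul]
    show ∫ y, ((g y : ℝ) : ℂ) = _
    exact integral_complex_ofReal
  have heq : w = fun _ => ((∫ y, g y : ℝ) : ℂ) := by
    refine eq_of_forall_mFourierCoeff_eq hwc continuous_const fun k => ?_
    rw [mFourierCoeff_const_real]
    by_cases hk : k = 0
    · subst hk
      rw [if_pos rfl, hmean]
    · rw [if_neg hk, hcoef k hk]
  have := congrFun heq x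
  simp only [hw, Function.comp_apply, Complex.ofRealCLM_apply, Complex.ofReal_inj] at this
  exact this

/-! ## The Laplacian of a mollification as a pairing with reflected kernels -/

/-- `Δ(f ⋆ k)(x) = ∫ f(y) Δ[k(x − ·)](y) dy` for `f ∈ L¹` and smooth `k`
(`Torus.laplacian_convolution` and `Torus.laplacian_comp_sub_left`). [folklore] -/
theorem laplacian_convolution_eq_integral {f : UnitAddTorus d → ℝ} (hf : Integrable f volume)
    {k : UnitAddTorus d → ℝ} (hk : IsSmooth k) (x : UnitAddTorus d) :
    Torus.laplacian (f ⋆ k) x = ∫ y, f y * Torus.laplacian (fun z => k (x - z)) y := by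
  rw [laplacian_convolution hf hk x, convolution_lsmul]
  refine integral_congr_ae (ae_of_all _ fun y => ?_)
  show f y • Torus.laplacian k (x - y) = f y * Torus.laplacian (fun z => k (x - z)) y
  rw [smul_eq_mul, laplacian_comp_sub_left hk x y]

/-! ## Weakly harmonic integrable functions are a.e. constant -/

/-- **Weyl's lemma on `T^d`, countable-family form.** Let `f ∈ L¹(T^d)` and let `D ⊆ T^d` be
dense. If `∫ f(y) Δ[k_n(x − ·)](y) dy = 0` for every `n` and every `x ∈ D`, where
`k_n = Torus.kernel (1/(n+4))` are the standard mollifiers, then `f` is a.e. equal to its mean.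
Proof: `f ⋆ k_n` is smooth with Laplacian vanishing on `D`, hence everywhere (continuity), hence
constant `= ∫ f`; and `f ⋆ k_n → f` in `L¹`. [cite: RobinsonRodrigoSadowskiCUP2016, Thm. 2.6] -/
theorem ae_eq_const_of_forall_integral_mul_laplacian_kernel_eq_zero {f : UnitAddTorus d → ℝ}
    (hf : Integrable f volume) {D : Set (UnitAddTorus d)} (hD : Dense D)
    (h : ∀ n : ℕ, ∀ x ∈ D,
      ∫ y, f y * Torus.laplacian (fun z => kernel (1 / ((n : ℝ) + 4)) (x - z)) y = 0) :
    f =ᵐ[volume] fun _ => ∫ y, f y := by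
  set K : ℕ → UnitAddTorus d → ℝ := fun n => kernel (1 / ((n : ℝ) + 4)) with hKdef
  have hrpos : ∀ n : ℕ, (0 : ℝ) < 1 / ((n : ℝ) + 4) := fun n => by positivity
  have hrle : ∀ n : ℕ, 1 / ((n : ℝ) + 4) ≤ (1 / 4 : ℝ) := fun n => by
    rw [div_le_div_iff₀ (by positivity) (by norm_num)]
    linarith [n.cast_nonneg (α := ℝ)]
  have hKs : ∀ n, IsSmooth (K n) := fun n => isSmooth_kernel (hrpos n) (hrle n)
  -- the mollifications are constant
  have hconst : ∀ n, f ⋆ K n = fun _ => ∫ y, f y := by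
    intro n
    have hg : IsSmooth (f ⋆ K n) := isSmooth_convolution hf (hKs n)
    have hΔ : Torus.laplacian (f ⋆ K n) = fun _ => 0 := by
      refine Continuous.ext_on hD hg.laplacian.continuous continuous_const fun x hx => ?_
      rw [laplacian_convolution_eq_integral hf (hKs n) x]
      exact h n x hx
    funext x
    rw [hg.eq_integral_of_laplacian_eq_zero (fun y => congrFun hΔ y) x,
      integral_convolution (ContinuousLinearMap.lsmul ℝ ℝ) hf
        (continuous_kernel (hrpos n) (hrle n)).integrable_unitAddTorus,
      ContinuousLinearMap.lsmul_apply, integral_kernel (hrpos n) (hrle n), smul_eq_mul, mul_one]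
  -- the approximate identity in `L¹`
  have hconv : Tendsto (fun n => eLpNorm (f ⋆ K n - f) 1 volume) atTop (𝓝 0) := by
    refine tendsto_eLpNorm_convolution_sub_self_of_eventually (Eventually.of_forall fun n =>
      ⟨kernel_nonneg (hrpos n).le, integral_kernel (hrpos n) (hrle n),
        continuous_kernel (hrpos n) (hrle n)⟩) (fun δ hδ => ?_) le_rfl ENNReal.one_ne_top
      (memLp_one_iff_integrable.2 hf)
    have hev : ∀ᶠ n : ℕ in atTop, 1 / ((n : ℝ) + 4) ≤ δ := by
      have ht : Tendsto (fun n : ℕ => 1 / ((n : ℝ) + 4)) atTop (𝓝 0) := by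
        have h1 : Tendsto (fun n : ℕ => (n : ℝ) + 4) atTop atTop :=
          tendsto_atTop_add_const_right _ _ tendsto_natCast_atTop_atTop
        exact tendsto_const_nhds.div_atTop h1
      exact ht.eventually (ge_mem_nhds hδ)
    filter_upwards [hev] with n hn
    exact (support_kernel_subset (hrpos n)).trans (ball_subset_ball hn)
  have hzero : eLpNorm ((fun _ => ∫ y, f y) - f) 1 volume = 0 := by
    have h1 : Tendsto (fun _ : ℕ => eLpNorm ((fun _ => ∫ y, f y) - f) 1 volume) atTop (𝓝 0) := by
      refine hconv.congr fun n => ?_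
      rw [hconst n]
    exact tendsto_nhds_unique tendsto_const_nhds h1
  have hae : ((fun _ => ∫ y, f y) - f) =ᵐ[volume] 0 :=
    (eLpNorm_eq_zero_iff (aestronglyMeasurable_const.sub hf.1) one_ne_zero).1 hzero
  filter_upwards [hae] with x hx
  have : (∫ y, f y) - f x = 0 := hx
  linarith

/-- **Weyl's lemma on `T^d` for integrable functions**: if `f ∈ L¹(T^d)` and `∫ f Δθ = 0` for
every smooth `θ`, then `f` is a.e. equal to its mean `∫ f` (the uniqueness, up to constants, in the
very weak Poisson problem; Robinson–Rodrigo–Sadowski 2016, Thm. 2.6). [cite: RobinsonRodrigoSadowskiCUP2016, Thm. 2.6] -/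
theorem ae_eq_const_of_forall_integral_mul_laplacian_eq_zero {f : UnitAddTorus d → ℝ}
    (hf : Integrable f volume)
    (h : ∀ θ : UnitAddTorus d → ℝ, IsSmooth θ → ∫ y, f y * Torus.laplacian θ y = 0) :
    f =ᵐ[volume] fun _ => ∫ y, f y := by
  refine ae_eq_const_of_forall_integral_mul_laplacian_kernel_eq_zero hf dense_univ fun n x _ => h _ ?_
  have hrpos : (0 : ℝ) < 1 / ((n : ℝ) + 4) := by positivity
  have hrle : 1 / ((n : ℝ) + 4) ≤ (1 / 4 : ℝ) := by
    rw [div_le_div_iff₀ (by positivity) (by norm_num)]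
    linarith [n.cast_nonneg (α := ℝ)]
  exact (isSmooth_kernel hrpos hrle).comp_sub_left x

end Literature.Analysis.FunctionSpaces.Torus

end
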